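import Literature.NumberTheory.LFunctions.MertensCertificate
import Summits.RiemannHypothesis.RiemannHypothesis.Theorems.Splittings.NbNaturalVisibilityClosed
import HarnessLib

/-!
# NB natural visibility — the constant `κ = ∫₀¹ |ζ(½+it)|² dt ≥ 1`, certified (SPLIT-nb-neg gen 8, §14)

Cell rh-split, seat rh-split-nb-neg g8 (brief sha16 f79c5f09d8bcb036), card
`run/shared/lean/pub/rh-split/cards/SPLIT-nb-neg.md` §14 (closes the g7 open item (γ) «κ uncertified»).

The landed closed-form visibility law `NbNaturalVisibility.kernel_visibility_explicit` (p501932) reads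
`6250144 · (2H⁵κ + 32(2+5πB)/δ²) < c₁(ρ₀)² κ x^δ ⟹ ∃ N ∈ [H, ⌊x⌋+1], bcfDistSq N > B`, with the one
non-explicit constant `κ = ∫₀¹ |ζ(½+it)|² dt` (`> 0` in the tree, `integral_norm_sq_riemannZeta_pos`;
numerically `κ = 1.2429…`).  This file certifies `κ ≥ 1` with the tree's validated `ζ`-evaluator
(`ZetaNumerics.zetaBox` / `mem_zetaBox` / `mkTables_valid`: Euler–Maclaurin in multi-precision interval
arithmetic, here with tables `mkTables 2¹¹⁰ 10 25 …` — scale `2¹¹⁰`, `N = 10`, `ν = 25`, the Taylor parameters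
of the Mertens certificate's `tablesT`) on the 1024 boxes `½ + i[k/1024, (k+1)/1024]`, and derives the
`κ`-FREE law `6250144 · (2H⁵ + 32(2+5πB)/δ²) < c₁(ρ₀)² x^δ ⟹ ∃ N ∈ [H, ⌊x⌋+1], bcfDistSq N > B`.
(Design note: the enclosure of `ζ` on a box of width `w` in `t` has width `≈ 62w` with `N = 10` but
`≈ 2650w` with the `N = 600` tables — interval dependency of the oscillating sum — so few EM terms and a
fine mesh are used; certified lower box sums: `1.163` (`N = 10`, mesh `1/1024`), against `0.632`
(`N = 600`, mesh `1/4096`).)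

Contents:
1. the checker — four small computational definitions (`sBox`, `dist0`, `boxLower`, `checkKappa`; pattern of
   `MertensCertificate.lean`, no mathematical content): box `k`, scaled distance of an interval from `0`,
   a certified lower bound (scale `ST²`) for `|ζ|²` on box `k`, and the comparison
   `Σ_{k<1024} boxLower ≥ 1024·ST²`;
2. soundness (standard axioms): `dist0_sq_le`, `mem_sBox`, `boxLower_le`, `one_le_kappa_of_check :
   checkKappa = true → 1 ≤ κ` (split `∫₀¹` at `k/1024`, bound each piece below by its box);
3. `kernel_visibility_of_one_le_kappa` (standard axioms): `1 ≤ κ` plus the `κ`-free inequality give the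
   visibility conclusion;
4. (in the companion module `NbKappaCertificateEval`, proposal flag `computational`) the compiled evaluation
   `checkKappa_holds : checkKappa = true` (`native_decide`) and the assembled `one_le_kappa`,
   `kernel_visibility_numeric`.  THIS module is standard-axioms only (hypothesis form).

HONEST LABEL: «SPLITTING SEARCH over kernel-typed RH-EQUIVALENCES; a splitting A ∧ B ⟹ RH is CONDITIONAL
bookkeeping unless A and B are both proved; nothing here bears on the truth of RH.»
-/

set_option linter.dupNamespace false

open Complex MeasureTheory Set
open scoped Real
open Literature.Analysis.ValidatedNumerics.NumericsMP
open Literature.NumberTheory.LFunctions.ZetaNumerics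
open Literature.NumberTheory.LFunctions.ZetaNumerics.Mertens

namespace Summit.RiemannHypothesis.RiemannHypothesis.Theorems.Splittings.NbKappaCertificate

open Literature.NumberTheory.LFunctions (continuous_riemannZeta_line bcfDistSq)
open Literature.Barriers.RiemannHypothesis.BettinGonek2017 (residueConst residueConst_pos)
open Summit.RiemannHypothesis.RiemannHypothesis.Theorems.Splittings.NbNaturalVisibility
  (kernel_visibility_explicit)

/-! ## 1. The checker -/

/-- Box `k` (`k < 1024`): `s = ½ + it`, `t ∈ [k/1024, (k+1)/1024]`, at scale `ST = 2¹¹⁰`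
(`(k/1024)·2¹¹⁰ = k·2¹⁰⁰` exactly). [folklore] -/
def sBox (k : ℕ) : MC := ⟨MI.ofFrac Mertens.ST 1 2, ⟨(k : ℤ) * 2 ^ 100, ((k : ℤ) + 1) * 2 ^ 100⟩⟩

/-- Scaled distance from `0` to the interval `I` (`0` if `0 ∈ I`). [folklore] -/
def dist0 (I : MI) : ℤ := max 0 (max I.lo (-I.hi))

/-- A certified lower bound, at scale `ST²`, for `|ζ(s)|²` on box `k` (`0` if the evaluator fails).
[folklore] -/
def boxLower (T : Tables) (k : ℕ) : ℤ :=
  match zetaBox T (sBox k) with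
  | none => 0
  | some Z => dist0 Z.re ^ 2 + dist0 Z.im ^ 2

/-- **The check**: with the tables `mkTables ST 10 25 24 140 40 30 4 16 6` (scale `ST = 2¹¹⁰`, `N = 10`
Euler–Maclaurin terms, `ν = 25` corrections; Taylor parameters of `Mertens.tablesT`),
`Σ_{k<1024} boxLower ≥ 1024·ST²`, i.e. the certified lower Riemann sum of `|ζ(½+it)|²` over `[0,1]` with
mesh `1/1024` is `≥ 1`. [folklore] -/
def checkKappa : Bool :=
  match mkTables Mertens.ST 10 25 24 140 40 30 4 16 6 with
  | none => false
  | some T => decide (1024 * (Mertens.ST : ℤ) ^ 2 ≤ ∑ k ∈ Finset.range 1024, boxLower T k)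

/-! ## 2. Soundness -/

/-- `dist0 I ≤ |x·S|`, hence `dist0(I)² ≤ (x·S)²`, for `x ∈ I`. [folklore] -/
theorem dist0_sq_le {S : ℕ} {x : ℝ} {I : MI} (hx : MI.mem S x I) :
    ((dist0 I : ℤ) : ℝ) ^ 2 ≤ (x * S) ^ 2 := by
  obtain ⟨hlo, hhi⟩ := hx
  have h1 : ((dist0 I : ℤ) : ℝ) ≤ |x * S| := by
    unfold dist0
    push_cast
    refine max_le (abs_nonneg _) (max_le (hlo.trans (le_abs_self _)) ?_)
    linarith [neg_abs_le (x * S)]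
  have h0 : (0 : ℝ) ≤ ((dist0 I : ℤ) : ℝ) := by
    unfold dist0; push_cast; exact le_max_left _ _
  calc ((dist0 I : ℤ) : ℝ) ^ 2 ≤ |x * S| ^ 2 := pow_le_pow_left₀ h0 h1 2
    _ = (x * S) ^ 2 := sq_abs _

/-- `½ + it ∈ sBox k` for `t ∈ [k/1024, (k+1)/1024]`. [folklore] -/
theorem mem_sBox {k : ℕ} {t : ℝ} (ht : t ∈ Set.Icc ((k : ℝ) / 1024) (((k : ℝ) + 1) / 1024)) :
    MC.mem Mertens.ST (1 / 2 + t * I) (sBox k) := by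
  have hre : (1 / 2 + t * I : ℂ).re = 1 / 2 := by simp
  have him : (1 / 2 + t * I : ℂ).im = t := by simp
  have hS : ((Mertens.ST : ℕ) : ℝ) = 1024 * 2 ^ 100 := by unfold Mertens.ST; norm_num
  refine ⟨?_, ?_⟩
  · show MI.mem Mertens.ST (1 / 2 + t * I : ℂ).re (MI.ofFrac Mertens.ST 1 2)
    rw [hre]
    have h := MI.mem_ofFrac Mertens.ST (1 : ℤ) (q := 2) two_pos
    have h12 : (((1 : ℤ) : ℝ) / ((2 : ℕ) : ℝ)) = 1 / 2 := by norm_num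
    rwa [h12] at h
  · show MI.mem Mertens.ST (1 / 2 + t * I : ℂ).im ⟨(k : ℤ) * 2 ^ 100, ((k : ℤ) + 1) * 2 ^ 100⟩
    rw [him]
    unfold MI.mem
    rw [hS]
    push_cast
    constructor <;> linarith [ht.1, ht.2]

/-- **Box soundness.** For `t ∈ [k/1024, (k+1)/1024]`: `boxLower T k ≤ |ζ(½+it)|² · ST²` (valid tables
at scale `ST`). [folklore] -/
theorem boxLower_le {T : Tables} (hT : T.Valid) (hTS : T.S = Mertens.ST) (k : ℕ) {t : ℝ}
    (ht : t ∈ Set.Icc ((k : ℝ) / 1024) (((k : ℝ) + 1) / 1024)) :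
    ((boxLower T k : ℤ) : ℝ) ≤ ‖riemannZeta (1 / 2 + t * I)‖ ^ 2 * ((Mertens.ST : ℕ) : ℝ) ^ 2 := by
  unfold boxLower
  split
  · push_cast; positivity
  · rename_i Z hZ
    have hs : MC.mem T.S (1 / 2 + t * I) (sBox k) := by rw [hTS]; exact mem_sBox ht
    have hs1 : (1 / 2 + t * I : ℂ) ≠ 1 := by
      intro h
      have := congrArg Complex.re h
      norm_num at this
    have hmem := mem_zetaBox hT hs hs1 hZ
    rw [hTS] at hmem
    have hre := dist0_sq_le hmem.1
    have him := dist0_sq_le hmem.2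
    push_cast
    have hn : ‖riemannZeta (1 / 2 + t * I)‖ ^ 2 * ((Mertens.ST : ℕ) : ℝ) ^ 2 =
        ((riemannZeta (1 / 2 + t * I)).re * (Mertens.ST : ℕ)) ^ 2 +
          ((riemannZeta (1 / 2 + t * I)).im * (Mertens.ST : ℕ)) ^ 2 := by
      rw [Complex.sq_norm, Complex.normSq_apply]; ring
    rw [hn]
    linarith

/-- **Soundness of the check**: `checkKappa = true ⟹ 1 ≤ ∫₀¹ |ζ(½+it)|² dt`. [folklore] -/
theorem one_le_kappa_of_check (h : checkKappa = true) :
    1 ≤ ∫ t in (0 : ℝ)..1, ‖riemannZeta (1 / 2 + t * I)‖ ^ 2 := by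
  unfold checkKappa at h
  generalize hTab : mkTables Mertens.ST 10 25 24 140 40 30 4 16 6 = o at h
  rcases o with _ | T
  · simp at h
  · simp only [decide_eq_true_eq] at h
    have hT : T.Valid := mkTables_valid hTab
    have hTS : T.S = Mertens.ST := mkTables_S hTab
    set f : ℝ → ℝ := fun t ↦ ‖riemannZeta (1 / 2 + t * I)‖ ^ 2 with hf
    have hcont : Continuous f := (continuous_riemannZeta_line.norm).pow 2
    have hSTpos : (0 : ℝ) < ((Mertens.ST : ℕ) : ℝ) ^ 2 := by unfold Mertens.ST; positivity
    -- split `[0, 1]` at the points `k/1024`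
    have hsplit : ∑ k ∈ Finset.range 1024, ∫ t in ((k : ℝ) / 1024)..(((k + 1 : ℕ) : ℝ) / 1024), f t =
        ∫ t in (((0 : ℕ) : ℝ) / 1024)..(((1024 : ℕ) : ℝ) / 1024), f t :=
      intervalIntegral.sum_integral_adjacent_intervals (a := fun k : ℕ ↦ (k : ℝ) / 1024)
        fun k _ ↦ hcont.intervalIntegrable _ _
    have h01 : ∫ t in (((0 : ℕ) : ℝ) / 1024)..(((1024 : ℕ) : ℝ) / 1024), f t =
        ∫ t in (0 : ℝ)..1, f t := by
      norm_num
    -- each piece is at least `boxLower / (1024 ST²)`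
    have hpiece : ∀ k ∈ Finset.range 1024, ((boxLower T k : ℤ) : ℝ) / (1024 * ((Mertens.ST : ℕ) : ℝ) ^ 2) ≤
        ∫ t in ((k : ℝ) / 1024)..(((k + 1 : ℕ) : ℝ) / 1024), f t := by
      intro k _
      have hab : (k : ℝ) / 1024 ≤ ((k + 1 : ℕ) : ℝ) / 1024 := by push_cast; linarith
      have hmono : ∫ _ in ((k : ℝ) / 1024)..(((k + 1 : ℕ) : ℝ) / 1024),
            ((boxLower T k : ℤ) : ℝ) / ((Mertens.ST : ℕ) : ℝ) ^ 2 ≤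
          ∫ t in ((k : ℝ) / 1024)..(((k + 1 : ℕ) : ℝ) / 1024), f t := by
        refine intervalIntegral.integral_mono_on hab intervalIntegrable_const
          (hcont.intervalIntegrable _ _) fun t ht' ↦ ?_
        have ht'' : t ∈ Set.Icc ((k : ℝ) / 1024) (((k : ℝ) + 1) / 1024) := by
          have : (((k + 1 : ℕ) : ℝ)) = (k : ℝ) + 1 := by push_cast; ring
          rw [this] at ht'
          exact ht'
        rw [div_le_iff₀ hSTpos]
        exact boxLower_le hT hTS k ht''
      rw [intervalIntegral.integral_const, smul_eq_mul] at hmono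
      have hlen : ((k + 1 : ℕ) : ℝ) / 1024 - (k : ℝ) / 1024 = 1 / 1024 := by push_cast; ring
      rw [hlen] at hmono
      calc ((boxLower T k : ℤ) : ℝ) / (1024 * ((Mertens.ST : ℕ) : ℝ) ^ 2)
          = 1 / 1024 * (((boxLower T k : ℤ) : ℝ) / ((Mertens.ST : ℕ) : ℝ) ^ 2) := by ring
        _ ≤ _ := hmono
    have hsum : (∑ k ∈ Finset.range 1024, ((boxLower T k : ℤ) : ℝ)) / (1024 * ((Mertens.ST : ℕ) : ℝ) ^ 2) ≤
        ∫ t in (0 : ℝ)..1, f t := by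
      rw [← h01, ← hsplit, Finset.sum_div]
      exact Finset.sum_le_sum hpiece
    have hcheck : 1024 * ((Mertens.ST : ℕ) : ℝ) ^ 2 ≤
        ∑ k ∈ Finset.range 1024, ((boxLower T k : ℤ) : ℝ) := by
      exact_mod_cast h
    have h1024 : (0 : ℝ) < 1024 * ((Mertens.ST : ℕ) : ℝ) ^ 2 := mul_pos (by norm_num) hSTpos
    calc (1 : ℝ) ≤ (∑ k ∈ Finset.range 1024, ((boxLower T k : ℤ) : ℝ)) /
          (1024 * ((Mertens.ST : ℕ) : ℝ) ^ 2) := by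
          rw [le_div_iff₀ h1024, one_mul]; exact hcheck
      _ ≤ _ := hsum

/-! ## 3. The `κ`-free visibility law (hypothesis form) -/

/-- **Kernel visibility law, closed form in `(H, B, ρ₀)` given `κ ≥ 1`.** For a zero `ρ₀` of `ζ` with
`Re ρ₀ ≥ ½ + δ` (`δ > 0`), `B ≥ 0`, `x ≥ 2` and `6250144 · (2H⁵ + 32(2+5πB)/δ²) < c₁(ρ₀)² x^δ`, some `N`
with `H ≤ N ≤ ⌊x⌋ + 1` has `bcfDistSq N > B` — the tree's `kernel_visibility_explicit` with its `κ` divided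
out (`2H⁵κ + 32(…)/δ² ≤ κ·(2H⁵ + 32(…)/δ²)` for `κ ≥ 1`). [cite: BettinGonek2017, §2 (engine)] -/
theorem kernel_visibility_of_one_le_kappa
    (hκ : 1 ≤ ∫ t in (0 : ℝ)..1, ‖riemannZeta (1 / 2 + t * I)‖ ^ 2)
    {ρ₀ : ℂ} (hζ : riemannZeta ρ₀ = 0) {δ : ℝ} (hδ : 0 < δ) (hβ : 1 / 2 + δ ≤ ρ₀.re) (H : ℕ)
    {B : ℝ} (hB0 : 0 ≤ B) {x : ℝ} (hx : 2 ≤ x)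
    (hbig : 6250144 * (2 * (H : ℝ) ^ 5 + 32 * (2 + 5 * π * B) / δ ^ 2) < residueConst ρ₀ ^ 2 * x ^ δ) :
    ∃ N : ℕ, H ≤ N ∧ N ≤ ⌊x⌋₊ + 1 ∧ B < bcfDistSq N := by
  set κ : ℝ := ∫ t in (0 : ℝ)..1, ‖riemannZeta (1 / 2 + t * I)‖ ^ 2 with hκdef
  refine kernel_visibility_explicit hζ hδ hβ H hB0 hx ?_
  rw [← hκdef]
  have hκ0 : 0 < κ := by linarith
  have hx0 : 0 < x := by linarith
  have hT : 0 ≤ 32 * (2 + 5 * π * B) / δ ^ 2 := by positivity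
  have hR : 0 < residueConst ρ₀ ^ 2 * x ^ δ :=
    mul_pos (pow_pos (residueConst_pos hζ (by linarith)) 2) (Real.rpow_pos_of_pos hx0 δ)
  calc 6250144 * (2 * ((H : ℝ) ^ 5 * κ) + 32 * (2 + 5 * π * B) / δ ^ 2)
      ≤ κ * (6250144 * (2 * (H : ℝ) ^ 5 + 32 * (2 + 5 * π * B) / δ ^ 2)) := by
        nlinarith [mul_nonneg hT (sub_nonneg.2 hκ)]
    _ < κ * (residueConst ρ₀ ^ 2 * x ^ δ) := mul_lt_mul_of_pos_left hbig hκ0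
    _ = residueConst ρ₀ ^ 2 * κ * x ^ δ := by ring

end Summit.RiemannHypothesis.RiemannHypothesis.Theorems.Splittings.NbKappaCertificate
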